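import Summits.ResolutionOfSingularities.ResolutionOfSingularities.Theorems.TightDefectStrongWalks
import Literature.AlgebraicGeometry.Resolution.PointBlowupMohBound
import Literature.AlgebraicGeometry.Resolution.PointBlowupKangaroo
import Literature.AlgebraicGeometry.Resolution.PointBlowupFlagTranslatedStep
import Literature.AlgebraicGeometry.Resolution.HasseSchmidtDerivatives
import Literature.AlgebraicGeometry.Resolution.PrincipalRidgeHasseCoefficients
import HarnessLib

/-!
# LassoCut — decomp-res node (lens-5, generation 13)

[WRITER NOTE (decomp-res writer g4). The lens-5 g13 node `LassoCut` (CRITIC-LEDGER row 78 / line 99, CLEARED «as is»)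
is filed as FOUR tree files because Theorems files with proofs are capped at 400 lines: `Theorems.LassoCutModel` (§1:
forced runs, `Lasso`, the PROVED pumping lemma — this file, which also keeps the node's docstring verbatim below),
`Theorems.LassoCutClasses` (§2 the pieces `NoLassos` / `NoAperiodicWalks` / `NoDefectLassosDeep` /
`NoAperiodicDefectWalksDeep` / `NoSatLassos` + the EXACT cuts + §3 the finite-field bridge), `Theorems.LassoCutAxisTails`
(§4 the decided cell `no_axis_tail` / `no_cornerMonoChart_lasso`), all three in the ONE namespace `…Theorems.LassoCut` and
Theses-free, and `Theorems.MaxContactCutLassoCut` (§5: the wiring to the MaxContactCut items 30253 / 31770 and to the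
asides `LCNoLassos` / `LCNoAperiodicWalks` / `LCNoDefectLassosDeep` / `LCNoAperiodicDefectWalksDeep` BY NAME).  Text below
unchanged; `closes` there means the host's `MaxContactCutExponentLadder.closes` (not restated).]

**Lens** «finite/base range + asymptotic regime + bridge», read on the TIME axis of a single forced walk of the
cell's typed model (`Theorems.TightDefectClasses`: `State`, `step`, `IsRoot`, `ForcedWalk`, `WalksTerminate`,
`DefectWalksTerminateDeep` = MaxContactCut item 31770 `DefectWalksDeep`, `SatDefectWalksTerminate` = the critic's
satellite column): a divergent witness either REVISITS a state — it is then a **LASSO**, a FINITE object — or it never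
does — it is then APERIODIC, and over a finite ground field it must ESCAPE every complexity box.

**The lever (new typed object + PROVED pumping).**  A `Lasso q s₀` is a finite forced run `s₀ → … → s_B` (the run
structure of lens-5 g11, verbatim) together with a repeat `s_{t₁} = s_{t₀}`, `t₀ < t₁ ≤ B`.  PUMPING LEMMA
(`Lasso.pump`, PROVED): a lasso IS an infinite forced walk — replay the cycle with the clock
`clock (t+1) = if clock t + 1 = t₁ then t₀ else clock t + 1`; every forced-step axiom (`st_succ`, `onExc`,
`equimult`, `isolated`) is inherited pointwise, positive tight defect along the run is inherited (`pump_shade`), and a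
satellite index INSIDE the cycle recurs infinitely often (`pump_satellite_io`, through `exists_clock_eq`).  Hence the
KERNEL CERTIFICATE CHANNEL: a lasso from a root is a Lean proof of `¬ WalksTerminate` (`not_walksTerminate_of_lasso`),
a positive-defect lasso at `e ≥ 2` refutes 31770 (`not_defectDeep_of_lasso`), a positive-defect lasso with a satellite
in its cycle refutes the satellite column (`not_satDefect_of_lasso`) — the census's bounded recurrence searches
(recipe replay, S₃-relabelled cycles) become REFUTATIONS WITH TEETH the moment they hit, with no port in between.

**The cut (EXACT, PROVED, pure logic + pumping).**
`WalksTerminate ⟺ NoLassos ∧ NoAperiodicWalks` (`walksTerminate_iff_lasso`),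
`DefectWalksTerminateDeep ⟺ NoDefectLassosDeep ∧ NoAperiodicDefectWalksDeep` (`defectDeep_iff_lasso`), and
`SatDefectWalksTerminate ⟹ NoSatLassos` (necessity of the satellite-cycle piece).  `NoLassos` is the Σ₁ HALF of the
crux: its failure has a FINITE witness, checkable by `decide`-style evaluation; `NoAperiodicWalks` is the Π HALF:
no finite computation can ever refute it.

**The bridge finite ↔ asymptotic (PROVED, pigeonhole).**  Two facts make it pigeonhole: (1) the walk is
STATE-DETERMINISTIC given its recipe (`ForcedWalk.st_succ`: `s_{t+1} = step q j_t b_t s_t`), and (2) over a FINITE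
field `K` (the regime lens-5 g11 `UniformWalks.finiteFieldCriterion` reduced the crux to, mod the two classical ports —
a HOME file awaiting filing, cited not re-typed) the STATE SPACE AT BOUNDED COMPLEXITY `cx s = deg F + |r| ≤ D` IS FINITE
(`finite_box`, explicit encoding).  So an infinite forced walk of bounded complexity revisits a state
(`exists_repeat_of_bounded`) and an APERIODIC one ESCAPES every box (`unbounded_of_aperiodic`): the finite-field class
splits EXACTLY as `FinWalksTerminate ⟺ NoFinLassos ∧ NoEscapingWalks` (`finWalksTerminate_iff`), the lasso piece IS the
bounded regime (`noFinLassos_iff_noBoxTowers`: no lassos ⟺ no BOUNDED towers; `NoEscapingWalks` = no UNBOUNDED ones), and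
the located residual of the whole model over finite fields is the ESCAPING TOWER: an infinite forced walk along which
`deg F_t + |r_t|` is unbounded (`|r_t|` is bounded at isolated top points once `u^r ∣ F` is booked —
`TightDefectStrongWalks.pair_lt_of_isolatedTop` — so: the DEGREE blows up).  Instruments can exhibit lassos (kernel
refutations) or growth (evidence only); nothing else exists.

**A decided cell (PROVED here): no AXIS TAILS.**  An infinite forced walk cannot have an eventually constant CORNER
recipe `(j_t, b_t) = (j, 0)` (`no_axis_tail`): the off-chart degree `|m| − m_j` of a monomial is invariant under the
`u_j`-chart exponent law, a monomial with off-chart degree `< q` loses total degree at every such step while orders stay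
`≥ q` (descent), and a polynomial all of whose monomials have off-chart degree `≥ q` has its top ideal inside the AXIS
ideal `(u_i : i ≠ j)`, contradicting `IsolatedTop` (`not_isolatedTop_of_offHeavy`).  Consequently the simplest lassos —
period one at a corner point, and every lasso whose cycle uses one chart and corner points only — do not exist
(`no_cornerMonoChart_lasso`): the first DECIDED cell of `NoLassos`.

**Tags.**  `NoLassos`, `NoDefectLassosDeep`, `NoSatLassos`, `NoFinLassos` [WEAKER by letter (necessity PROVED by
pumping) · Σ₁ · INSTRUMENTABLE-WITH-CERTIFICATE · conjecturally TRUE; a proof for all parameters is IDEA-NEEDED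
(valuative rigidity of the functional equation `F ∘ Φ = M·(F + Q)` of a cycle) · decided cell `no_cornerMonoChart_lasso`];
`NoAperiodicWalks`, `NoAperiodicDefectWalksDeep` [WEAKER by letter · Π · the located residual · IDEA-NEEDED];
`NoEscapingWalks` [finite fields: WEAKER by letter · EXACT complement of the lasso piece by pigeonhole · the residual in
the finite-field regime = DEGREE BLOW-UP · instrument-dark (growth is evidence, never a certificate) · IDEA-NEEDED];
`FinWalksTerminate` [WEAKER (instantiation) · ⟺ `WalksTerminate` mod lens-5 g11's ports at each degree]; ports: none new.
`closes` = `MaxContactCutExponentLadder.closes` BY NAME (host cone unchanged; this node is an aside ladder under 30253 /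
31770 through `TightDefectClasses.walksTerminate_iff`, `MaxContactCutTightDefect.defectWalksDeep_iff`).

Sources: Hauser2010 §§F–G (the point-blow-up calculus, kangaroo points); Moh1987; HauserPerlega2019 (cycles of the
residual order in dimension ≥ 4 — NOT forced: no isolated cycles are known, loc. cit. §1); CossartJannsenSaito2020
Cor. 5.37; Benito–Villamayor 2013 §7; lens-5 g11 `UniformWalks` (finite-field criterion), lens-3 g11 `BoundaryLedger`
(`|r| < 2q`).  No instances, no notation, no `set_option`; tree-only imports; 0 sorry.
-/

open MvPolynomial
open Literature.AlgebraicGeometry.Resolution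
open Literature.AlgebraicGeometry.Resolution.Hauser2010
open Literature.AlgebraicGeometry.Resolution.PointBlowup
open Summit.ResolutionOfSingularities.ResolutionOfSingularities.Theorems.TightDefectClasses
open Summit.ResolutionOfSingularities.ResolutionOfSingularities.Theorems.WeakOrderReduction
open Summit.ResolutionOfSingularities.ResolutionOfSingularities.Theorems.ForcedTowerClasses

namespace Summit.ResolutionOfSingularities.ResolutionOfSingularities.Theorems.LassoCut

/-! ## §1 Forced runs, lassos, and the PUMPING LEMMA (any index type `σ`, any field) -/

section Model

variable {σ : Type} [DecidableEq σ] {K : Type} [Field K] [DecidableEq K]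

/-- A FORCED RUN of length `B`: the first `B` steps of a would-be forced walk (fields constrained for `i < B` only;
junk beyond).  DEFINITION (support; verbatim the run structure of lens-5 g11 `UniformWalks.ForcedRun`). (Sources:
Hauser2010, §§F–G.) -/
structure ForcedRun (q : ℕ) (s₀ : State σ K) (B : ℕ) where
  /-- the chart of the `i`-th point blow-up (`i < B`) -/
  j : ℕ → σ
  /-- the point of the `i`-th exceptional divisor blown up next (`i < B`) -/
  b : ℕ → σ → K
  /-- the states `st 0, …, st B` -/
  st : ℕ → State σ K
  st_zero : st 0 = s₀
  st_succ : ∀ i, i < B → st (i + 1) = step q (j i) (b i) (st i)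
  onExc : ∀ i, i < B → b i (j i) = 0
  equimult : ∀ i, i < B → IsEquimultiplePoint q (j i) (b i) (st i)
  isolated : ∀ i, i < B → IsolatedTop q (st i).F

/-- Truncation of an infinite forced walk to a run of any length. [folklore] -/
def runOf {q : ℕ} {s₀ : State σ K} (W : ForcedWalk q s₀) (B : ℕ) : ForcedRun q s₀ B where
  j := W.j
  b := W.b
  st := W.st
  st_zero := W.st_zero
  st_succ := fun i _ => W.st_succ i
  onExc := fun i _ => W.onExc i
  equimult := fun i _ => W.equimult i
  isolated := fun i _ => W.isolated i

/-- The `i`-th point of a run is a SATELLITE point (same letter as `ForcedWalk.Satellite`). DEFINITION (support).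
(Sources: Hauser2010, §G.) -/
def ForcedRun.Satellite {q : ℕ} {s₀ : State σ K} {B : ℕ} (R : ForcedRun q s₀ B) (i : ℕ) : Prop :=
  ∃ i' : σ, i' ≠ R.j i ∧ R.b i i' = 0 ∧ 0 < (R.st i).r i'

/-- **LASSO** — the node's new typed object: a forced run that CLOSES UP, `st t₁ = st t₀` with `t₀ < t₁ ≤ B`
(a stem `s₀ → … → s_{t₀}` and a cycle `s_{t₀} → … → s_{t₁} = s_{t₀}` of legal forced steps).
THE CERTIFICATE DATA:
the length `B`, the recipe `(j_i, b_i)_{i<B}` (charts and points), the states, the legality proofs, and `t₀ < t₁`; the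
STATE that must repeat is EXACTLY the tree's `State (Fin 3) K` = (the cleaned polynomial `F` — after `deletePthPowers`,
no further normalisation, no relabelling — and the boundary vector `r : Fin 3 →₀ ℕ`); the tight defect `shade` is a
FUNCTION of the state, and the model's `step q j b` is a FUNCTION of (state, recipe), which is what makes the periodic
replay of the recipe reproduce the states (`st_clock_succ`).  A FINITE object: over a finite field with bounded
degrees its existence is a finite search.  DEFINITION (new typed object). (Sources: HauserPerlega2019, §1 (cycles
of the residual order).) -/
structure Lasso (q : ℕ) (s₀ : State σ K) where
  /-- length of the recorded run -/
  B : ℕ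
  /-- the run -/
  run : ForcedRun q s₀ B
  /-- start of the cycle -/
  t₀ : ℕ
  /-- end of the cycle -/
  t₁ : ℕ
  lt : t₀ < t₁
  le : t₁ ≤ B
  /-- the run closes up -/
  closes_up : run.st t₁ = run.st t₀

namespace Lasso

variable {q : ℕ} {s₀ : State σ K}

/-- The PUMPING CLOCK: run time as a function of walk time (wrap from `t₁ − 1` back to `t₀`). DEFINITION (support). -/
def clock (L : Lasso q s₀) : ℕ → ℕ
  | 0 => 0
  | t + 1 => if clock L t + 1 = L.t₁ then L.t₀ else clock L t + 1

/-- The clock starts at `0`. [folklore] -/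
theorem clock_zero (L : Lasso q s₀) : L.clock 0 = 0 := rfl

/-- The clock steps by one and jumps back from `t₁` to `t₀`. [folklore] -/
theorem clock_succ (L : Lasso q s₀) (t : ℕ) :
    L.clock (t + 1) = if L.clock t + 1 = L.t₁ then L.t₀ else L.clock t + 1 := rfl

/-- The clock stays inside the recorded cycle range `[0, t₁)`. [folklore] -/
theorem clock_lt (L : Lasso q s₀) (t : ℕ) : L.clock t < L.t₁ := by
  induction t with
  | zero => exact lt_of_le_of_lt (Nat.zero_le _) L.lt
  | succ t ih =>
    rw [clock_succ]
    split_ifs with h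
    · exact L.lt
    · omega

/-- The clock stays inside the run. [folklore] -/
theorem clock_lt_B (L : Lasso q s₀) (t : ℕ) : L.clock t < L.B :=
  lt_of_lt_of_le (L.clock_lt t) L.le

/-- Before the first wrap the clock is the identity. [folklore] -/
theorem clock_eq_self (L : Lasso q s₀) {t : ℕ} (ht : t < L.t₁) : L.clock t = t := by
  induction t with
  | zero => rfl
  | succ t ih =>
    rw [clock_succ, ih (by omega), if_neg (by omega)]

/-- The clock advances without wrapping as long as it stays below `t₁`. [folklore] -/
theorem clock_add (L : Lasso q s₀) (t : ℕ) {k : ℕ} (h : L.clock t + k < L.t₁) : L.clock (t + k) = L.clock t + k := by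
  induction k with
  | zero => rfl
  | succ k ih =>
    have ih' := ih (by omega)
    rw [← Nat.add_assoc, clock_succ, ih', if_neg (by omega)]
    omega

/-- **Recurrence of the cycle**: every cycle index `c ∈ [t₀, t₁)` is hit by the clock beyond any bound. [folklore] -/
theorem exists_clock_eq (L : Lasso q s₀) {c : ℕ} (h₀ : L.t₀ ≤ c) (h₁ : c < L.t₁) (N : ℕ) :
    ∃ t, N ≤ t ∧ L.clock t = c := by
  have ha := L.clock_lt N
  by_cases hca : L.clock N ≤ c
  · refine ⟨N + (c - L.clock N), by omega, ?_⟩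
    rw [L.clock_add N (by omega)]
    omega
  · have h1 : L.clock (N + (L.t₁ - 1 - L.clock N)) = L.t₁ - 1 := by
      rw [L.clock_add N (by omega)]
      omega
    have h2 : L.clock (N + (L.t₁ - 1 - L.clock N) + 1) = L.t₀ := by
      rw [clock_succ, h1, if_pos (by omega)]
    refine ⟨N + (L.t₁ - 1 - L.clock N) + 1 + (c - L.t₀), by omega, ?_⟩
    rw [L.clock_add _ (by rw [h2]; omega), h2]
    omega

/-- The step law along the clock (the wrap uses the closing equation `st t₁ = st t₀`). [folklore] -/
theorem st_clock_succ (L : Lasso q s₀) (t : ℕ) :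
    L.run.st (L.clock (t + 1)) = step q (L.run.j (L.clock t)) (L.run.b (L.clock t)) (L.run.st (L.clock t)) := by
  rw [clock_succ]
  split_ifs with h
  · rw [← L.closes_up, ← h]
    exact L.run.st_succ _ (by have := L.le; omega)
  · exact L.run.st_succ _ (L.clock_lt_B t)

/-- **PUMPING LEMMA**: a lasso IS an infinite forced walk (replay the cycle forever).  [PROVED · the kernel behind every
certificate of this node] (Sources: HauserPerlega2019, §1.) -/
def pump (L : Lasso q s₀) : ForcedWalk q s₀ where
  j t := L.run.j (L.clock t)
  b t := L.run.b (L.clock t)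
  st t := L.run.st (L.clock t)
  st_zero := by rw [clock_zero, L.run.st_zero]
  st_succ t := L.st_clock_succ t
  onExc t := L.run.onExc _ (L.clock_lt_B t)
  equimult t := L.run.equimult _ (L.clock_lt_B t)
  isolated t := L.run.isolated _ (L.clock_lt_B t)

/-- The pumped walk at time `t` is the run at clock time. [folklore] -/
theorem pump_st (L : Lasso q s₀) (t : ℕ) : L.pump.st t = L.run.st (L.clock t) := rfl

/-- Positive tight defect along the recorded run pumps to positive tight defect forever. [folklore] -/
theorem pump_shade (L : Lasso q s₀) (h : ∀ i, i < L.t₁ → 1 ≤ (L.run.st i).shade) (t : ℕ) :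
    1 ≤ (L.pump.st t).shade :=
  h _ (L.clock_lt t)

/-- The cycle of the lasso contains a satellite point. DEFINITION (support). (Sources: Hauser2010, §G.) -/
def SatCycle (L : Lasso q s₀) : Prop :=
  ∃ c, L.t₀ ≤ c ∧ c < L.t₁ ∧ L.run.Satellite c

/-- A satellite point INSIDE THE CYCLE pumps to infinitely many satellite points. [folklore] -/
theorem pump_satellite_io (L : Lasso q s₀) (hL : L.SatCycle) (N : ℕ) : ∃ t, N ≤ t ∧ L.pump.Satellite t := by
  obtain ⟨c, h₀, h₁, hc⟩ := hL
  obtain ⟨t, hNt, htc⟩ := L.exists_clock_eq h₀ h₁ N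
  refine ⟨t, hNt, ?_⟩
  show ∃ i', i' ≠ L.run.j (L.clock t) ∧ L.run.b (L.clock t) i' = 0 ∧ 0 < (L.run.st (L.clock t)).r i'
  rw [htc]
  exact hc

/-- Positive tight defect along the recorded part of the run. DEFINITION (support). -/
def PosDefect (L : Lasso q s₀) : Prop :=
  ∀ i, i < L.t₁ → 1 ≤ (L.run.st i).shade

end Lasso

/-- An infinite forced walk is APERIODIC: it never revisits a state. DEFINITION (support). -/
def Aperiodic {q : ℕ} {s₀ : State σ K} (W : ForcedWalk q s₀) : Prop :=
  ∀ t₀ t₁ : ℕ, t₀ < t₁ → W.st t₁ ≠ W.st t₀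

/-- Restriction: a walk that revisits a state yields a lasso (its own prefix). [folklore] -/
def lassoOf {q : ℕ} {s₀ : State σ K} (W : ForcedWalk q s₀) {t₀ t₁ : ℕ} (h : t₀ < t₁) (he : W.st t₁ = W.st t₀) :
    Lasso q s₀ where
  B := t₁
  run := runOf W t₁
  t₀ := t₀
  t₁ := t₁
  lt := h
  le := le_rfl
  closes_up := he

/-- The run of `lassoOf W` is `W` restricted. [folklore] -/
theorem lassoOf_run_st {q : ℕ} {s₀ : State σ K} (W : ForcedWalk q s₀) {t₀ t₁ : ℕ} (h : t₀ < t₁)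
    (he : W.st t₁ = W.st t₀) : (lassoOf W h he).run.st = W.st := rfl

/-- The repeat time of `lassoOf W` is `t₁`. [folklore] -/
theorem lassoOf_t₁ {q : ℕ} {s₀ : State σ K} (W : ForcedWalk q s₀) {t₀ t₁ : ℕ} (h : t₀ < t₁)
    (he : W.st t₁ = W.st t₀) : (lassoOf W h he).t₁ = t₁ := rfl

/-- Dichotomy: a walk is aperiodic or revisits a state. [folklore] -/
theorem aperiodic_or_repeat {q : ℕ} {s₀ : State σ K} (W : ForcedWalk q s₀) :
    Aperiodic W ∨ ∃ t₀ t₁, t₀ < t₁ ∧ W.st t₁ = W.st t₀ := by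
  by_cases h : Aperiodic W
  · exact Or.inl h
  · simp only [Aperiodic, not_forall, not_not] at h
    obtain ⟨t₀, t₁, hlt, heq⟩ := h
    exact Or.inr ⟨t₀, t₁, hlt, heq⟩

end Model

end Summit.ResolutionOfSingularities.ResolutionOfSingularities.Theorems.LassoCut
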